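import Literature.AlgebraicGeometry.HodgeTheory.AbelianVarietyHodgeHomFullnessHolds
import Literature.AlgebraicGeometry.ComplexMultiplication.PrincipalModelOfCMOrder
import Literature.AlgebraicGeometry.ComplexMultiplication.ShimuraInflationBettiJunctions
import Literature.AlgebraicGeometry.ComplexMultiplication.EndAlgebraCommSubalgebraDegreeBound
import Literature.AlgebraicGeometry.Milne1999.CMTypeSimpleIsogenyFactors
import Literature.AlgebraicGeometry.HodgeTheory.WeilFamilyReachOfPeriodConstruction
import Summits.HodgeConjecture.HodgeConjecture.Theorems.EightfoldBlochSeedsReachHyperbolicRiemannRealisableHodgeHalf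
import Literature.AlgebraicGeometry.HodgeTheory.HodgeFrameTransportOfIso
import Literature.AlgebraicGeometry.HodgeTheory.HodgeTypePullback
import Literature.AlgebraicGeometry.Motives.AbelianVarietyIsogenyProofs
import HarnessLib

/-!
# Route `EightfoldBlochSeeds`, crux `ReachHyperbolic` (item stmt-HodgeConjecture-18883), line `moduli-riemann`
# (`Cruxes/ReachHyperbolic/Lines/moduli_riemann.lean` 1ba65e5152037605): THE MATHEMATICAL CONTENT OF THE REGISTERED STUB
# `stub_riemannRealisable` — RIEMANN'S EXISTENCE THEOREM AT WEIL TYPE, every `n, d ≥ 1` — PROVED (unfolded form)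

HONEST FRAMING. This file proves, sorry-free and unconditionally, the BODY of the skeleton's `RealisedBy n d … J hW B Φ β` for every
Weil complex structure `J` — i.e. the statement of `stub_riemannRealisable : ∀ n d, 1 ≤ n → 1 ≤ d → RiemannRealisableAt n d` with the
skeleton-local definitions `RiemannRealisableAt` / `RealisedBy` UNFOLDED (they live in the crux workfile and are not importable here;
the stub's extra hypothesis `IsWeilType P ψ₀ n d` is not even needed). It does NOT prove the crux `ReachHyperbolic` (whose other stub,
`stub_moduliComplete` = Deligne's universal PEL family (J1), is genuinely absent from the tree), rung H2, HC_AV or HC. No definition, no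
named fact as hypothesis, no Literature fact introduced (D-0026). The lead closes the stub BY NAME with
`exact fun n d _ _ P ψ₀ e a hP ha ha0 _ m hm hPm hd' hψ ω hω hω0 J hW =>
  Summit.HodgeConjecture.HodgeConjecture.Theorems.exists_realisedBy_of_isWeilComplexStructure e ha ha0 hm hPm hd' hψ hω hω0 hP J hW`.

WHAT IS HERE (leafhand `leafhand-hodge-eightfoldblochseed-1-g0`). The line card filed the stub as «XL · Leans on: nothing in Mathlib
(no complex tori / theta functions); tree has only the converse `hodgeIso_bettiOne_isogeny`». The tree in fact holds every brick, and
this file is their assembly: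

* STAGE A `exists_end_of_hodgeEndomorphism_sq` — a `ℚ`-endomorphism `α` of `H¹(B(ℂ); ℚ)` with `α² = -d` preserving the `(1,0)`-classes is
  `k⁻¹ u₀^*` for some `u₀ ∈ End B`, `k ≥ 1` (Riemann FULLNESS, `HodgeTheory.exists_hom_map_eq_nsmul_of_oneZero` = Deligne–Milne Thm. 6.20
  with its `(1,0)`-clause form), and `u₀ ≫ u₀ = -(k²d)·𝟙_B` (faithfulness `AbelianVariety.hom_eq_of_bettiCohomology_map_one_eq`).
* STAGE B `exists_isogenous_sqrt_of_sq` — from `u₀² = -k²d`: `x = k⁻¹u₀ ∈ End⁰(B)` has `x² = -d`, so `X ↦ x` is a ring map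
  `ℤ[X]/(X² + d) → End⁰(B)` (`Polynomial.eval₂RingHom'`, `Ideal.Quotient.lift`); Shimura's PRINCIPAL MODEL
  (`ComplexMultiplication.exists_principalModel`, §7.1 Prop. 7, with the power basis of `AdjoinRoot`) is an isogenous `B'` (`u`, `v`,
  `uv = vu = [m]`) on which the order acts by genuine endomorphisms: `Φ := ρ(X)`, `Φ ≫ Φ = -d·𝟙_{B'}` EXACTLY, and on `H¹` (rational
  representation `ComplexMultiplication.bettiRep`, transport `AbelianVariety.endAlgebraTransport`) `Φ^* = (km)⁻¹ · v^* u₀^* u^*`.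
* STAGE C `exists_realisedBy_of_isWeilComplexStructure` — for the rational Weil datum `weilDatumOfKsymm …` of `(P, ψ₀, h_K, ω)` and
  `J ∈ X⁺`: `J`'s Hodge structure is polarised (`WeilDatum.isPolarizable_hodgeStructure`) and effective, so Riemann's ESSENTIAL IMAGE
  (`HodgeTheory.exists_abelianVariety_bettiOneHodgeStructure_hom_bijective`: polarised tori are abelian varieties — theta functions,
  Chow, GAGA, all in the tree) gives `B` and a Hodge isomorphism `f : H¹_B(B) ≅ H_J` with inverse `g`; `α_B := g ψ₀^* f` preserves
  `(1,0)`-classes (`ψ₀^*` commutes with `J`: `WeilDatum.αℝ_realJ`, `HodgeStructure.baseChange_mem_cxF1`; model independence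
  `HodgeModel.mem_ratPiece_of_isOfHodgeType`); stages A and B give `(B', Φ)`; the marking `β' := v^* ∘ g` is an isomorphism
  (`u^*v^* = v^*u^* = m`), intertwines `ψ₀^*` with `Φ^*`, and carries `H^{1,0}_J` into `H^{1,0}(B')` (junction
  `Theorems.isOfHodgeType_of_mem_piece_bettiOneHodgeStructure` of the Hodge-half file, then pull-back along `v`,
  `IsOfHodgeType.map_of_le`, `HodgeModel.ofRatClassBaseChange_baseChange_map`); `dim B' = dim B = b₁(P)/2 = 2n`.

WHAT IS NOT HERE = `stub_moduliComplete` (the universal PEL family with level structure, complete for realisable periods = the named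
fact (J1) `deligne1982_weilFamily_periodConstructionAtWeilType`; see `Theorems/EightfoldBlochSeedsReachHyperbolicOfPeriodConstructionAtWeilType.lean`).

## References

[cite: DeligneMilne1982Tannakian, art. II §6 Thm. 6.20 (Riemann)] [cite: Deligne1982HodgeCycles, §4 Prop. 4.4, Lemma 4.6, proof of Thm. 4.8 (p. 47)]
[cite: Shimura1998, §7.1 Prop. 7 and §7.2] [cite: MumfordAV1970, §1–§3 and §19 Remark p. 169] [cite: BirkenhakeLange2004, Thm. 4.2.1]
[cite: Lange2023AbelianVarietiesComplex, Prop. 1.1.6 (b), Lemma 1.1.11] [cite: vanGeemen1994HodgeAV, 5.5–5.7]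
-/

noncomputable section

-- single-problem summit (Problem = Summit): the mandated namespace repeats `HodgeConjecture`.
set_option linter.dupNamespace false

open CategoryTheory AlgebraicGeometry
open scoped TensorProduct
open Literature.AlgebraicGeometry Literature.AlgebraicGeometry.Motives Literature.AlgebraicGeometry.HodgeTheory
open Literature.AlgebraicGeometry.ComplexMultiplication
open Literature.AlgebraicTopology.SingularHomology

namespace Summit.HodgeConjecture.HodgeConjecture.Theorems

/-- **Stage A (fullness + faithfulness).** A `ℚ`-linear endomorphism `α` of `H¹(B(ℂ); ℚ)` with `α² = -d` whose complexification
preserves the `(1,0)`-classes is `k⁻¹ u₀^*` for an endomorphism `u₀` of `B` and some `k ≥ 1` (Riemann's theorem, fullness clause: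
`exists_hom_map_eq_nsmul_of_oneZero`), and then `u₀ ≫ u₀ = -(k²d)·𝟙_B` (faithfulness of `u ↦ u^*`,
`AbelianVariety.hom_eq_of_bettiCohomology_map_one_eq`). [cite: DeligneMilne1982Tannakian, art. II §6 Thm. 6.20]
[cite: Lange2023AbelianVarietiesComplex, Prop. 1.1.6 (b)] -/
theorem exists_end_of_hodgeEndomorphism_sq {B : AbelianVariety ℂ} (αB : bettiCohomology B.X 1 →ₗ[ℚ] bettiCohomology B.X 1)
    {d : ℕ} (hsq : ∀ y, αB (αB y) = -((d : ℚ) • y))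
    (hH : ∀ y : ℂ ⊗[ℚ] bettiCohomology B.X 1,
      IsOfHodgeType B.dim B.X 1 1 0 (Motives.ofRatClassBaseChange (ComplexPoints B.X) 1 y) →
      IsOfHodgeType B.dim B.X 1 1 0 (Motives.ofRatClassBaseChange (ComplexPoints B.X) 1 (αB.baseChange ℂ y))) :
    ∃ (u₀ : B ⟶ B) (k : ℕ), 0 < k ∧ (∀ y, bettiCohomology.map u₀.hom.hom.hom 1 y = k • αB y) ∧
      u₀ ≫ u₀ = -((k * k * d) • 𝟙 B) := by
  obtain ⟨u₀, k, hk, hu⟩ := exists_hom_map_eq_nsmul_of_oneZero B B αB hH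
  refine ⟨u₀, k, hk, hu, eq_neg_of_add_eq_zero_left ?_⟩
  apply AbelianVariety.hom_eq_of_bettiCohomology_map_one_eq
  rw [bettiCohomology_map_add_one, bettiCohomology_map_comp_hom, bettiCohomology_map_nsmul_id_one,
    bettiCohomology_map_zero_one]
  ext y
  rw [ModuleCat.hom_add, LinearMap.add_apply, ModuleCat.hom_comp, LinearMap.comp_apply, hu, hu, map_nsmul, hsq,
    ModuleCat.hom_zero, LinearMap.zero_apply]
  change k • k • -((d : ℚ) • y) + ((k * k * d) • (LinearMap.id : bettiCohomology B.X 1 →ₗ[ℚ] _)) y = 0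
  rw [LinearMap.smul_apply, LinearMap.id_apply, ← Nat.cast_smul_eq_nsmul ℚ k, ← Nat.cast_smul_eq_nsmul ℚ k,
    ← Nat.cast_smul_eq_nsmul ℚ (k * k * d), smul_neg, smul_neg, smul_smul, smul_smul]
  push_cast
  rw [neg_add_eq_zero, mul_assoc]

/-- **Stage B (principal model for the order `ℤ[√-d]`).** If `u₀ ∈ End B` satisfies `u₀ ≫ u₀ = -(k²d)·𝟙_B` with `k ≥ 1`, then
`x = k⁻¹·u₀ ∈ End⁰(B)` has `x² = -d`, so `X ↦ x` defines `ψ : ℤ[X]/(X² + d) → End⁰(B)`; Shimura's principal model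
(`exists_principalModel`, §7.1 Prop. 7) gives an isogenous `B'` (`u : B → B'`, `v : B' → B`, `u v = v u = [m]`) on which the order
acts by genuine endomorphisms: `Φ := ρ(X)` has `Φ ≫ Φ = -d·𝟙_{B'}` EXACTLY, and on `H¹` (rational representation `bettiRep`,
transport `endAlgebraTransport`) `Φ^* = (km)⁻¹ · v^* u₀^* u^*`. [cite: Shimura1998, §7.1 Prop. 7] [cite: MumfordAV1970, §19 Remark p. 169] -/
theorem exists_isogenous_sqrt_of_sq {B : AbelianVariety ℂ} {u₀ : B ⟶ B} {k d : ℕ} (hk : 0 < k)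
    (hu : u₀ ≫ u₀ = -((k * k * d) • 𝟙 B)) :
    ∃ (B' : AbelianVariety ℂ) (u : B ⟶ B') (v : B' ⟶ B) (m : ℕ) (_ : 0 < m) (_ : u ≫ v = m • 𝟙 B)
      (_ : v ≫ u = m • 𝟙 B') (Φ : B' ⟶ B'),
      AbelianVariety.IsIsogeny u ∧ Φ ≫ Φ = -(d • 𝟙 B') ∧
      ∀ z, bettiCohomology.map Φ.hom.hom.hom 1 z =
        ((k : ℚ) * m)⁻¹ • bettiCohomology.map v.hom.hom.hom 1
          (bettiCohomology.map u₀.hom.hom.hom 1 (bettiCohomology.map u.hom.hom.hom 1 z)) := by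
  classical
  -- the element `x = k⁻¹ u₀` of `End⁰(B)` and its square
  set x : B.endAlgebra := algebraMap ℚ B.endAlgebra ((k : ℚ)⁻¹) * AbelianVariety.endAlgebra.of B (End.of u₀) with hxdef
  have hk' : (k : ℚ) ≠ 0 := Nat.cast_ne_zero.2 hk.ne'
  have hsqEnd : (End.of u₀ : End B) * End.of u₀ = -((k * k * d : ℕ) : End B) := by
    rw [End.mul_def]
    change u₀ ≫ u₀ = _
    rw [hu, ← nsmul_one, End.one_def]
    rfl
  have hx2 : x * x = algebraMap ℚ B.endAlgebra (-(d : ℚ)) := by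
    have hcomm : Commute (algebraMap ℚ B.endAlgebra ((k : ℚ)⁻¹)) (AbelianVariety.endAlgebra.of B (End.of u₀)) :=
      Algebra.commutes _ _
    rw [hxdef, mul_assoc, ← mul_assoc (AbelianVariety.endAlgebra.of B (End.of u₀)), ← hcomm.eq, mul_assoc, ← map_mul,
      hsqEnd, map_neg, map_natCast, ← mul_assoc, ← map_mul, mul_neg, ← map_natCast (algebraMap ℚ B.endAlgebra),
      ← map_mul, ← map_neg]
    congr 1
    push_cast
    field_simp
  -- the order `ℤ[X]/(X² + d)` and `ψ : X ↦ x`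
  set f : Polynomial ℤ := Polynomial.X ^ 2 + Polynomial.C (d : ℤ) with hfdef
  have hfm : f.Monic := Polynomial.monic_X_pow_add_C (d : ℤ) two_ne_zero
  have hevgen : ∀ (S : Type) [Ring S] (g : ℤ →+* S) (y : S), Polynomial.eval₂ g y f = y * y + g d := by
    intro S _ g y
    rw [hfdef, Polynomial.eval₂_add, Polynomial.eval₂_X_pow, Polynomial.eval₂_C, pow_two]
  have hevf : Polynomial.eval₂ (algebraMap ℤ B.endAlgebra) x f = 0 := by
    rw [hevgen, hx2, map_natCast, ← map_natCast (algebraMap ℚ B.endAlgebra), ← map_add, neg_add_cancel, map_zero]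
  let ψ₀ : Polynomial ℤ →+* B.endAlgebra :=
    Polynomial.eval₂RingHom' (algebraMap ℤ B.endAlgebra) x fun a => Algebra.commute_algebraMap_left a x
  have hψ₀ : ∀ a ∈ Ideal.span {f}, ψ₀ a = 0 := by
    intro a ha
    obtain ⟨b, rfl⟩ := Ideal.mem_span_singleton'.1 ha
    change Polynomial.eval₂ (algebraMap ℤ B.endAlgebra) x (b * f) = 0
    rw [Polynomial.eval₂_mul_noncomm _ _ fun c => Algebra.commute_algebraMap_left (f.coeff c) x, hevf, mul_zero]
  let ψ : AdjoinRoot f →+* B.endAlgebra := Ideal.Quotient.lift (Ideal.span {f}) ψ₀ hψ₀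
  have hψroot : ψ (AdjoinRoot.root f) = x := by
    change Ideal.Quotient.lift (Ideal.span {f}) ψ₀ hψ₀ (Ideal.Quotient.mk _ Polynomial.X) = x
    rw [Ideal.Quotient.lift_mk]
    exact Polynomial.eval₂_X _ _
  -- Shimura's principal model
  obtain ⟨B', u, v, m, hm, huv, hvu, ρ, hu', hρ⟩ := exists_principalModel (AdjoinRoot.powerBasis' hfm).basis ψ
  have hroot2 : AdjoinRoot.root f * AdjoinRoot.root f = -((d : ℤ) : AdjoinRoot f) := by
    have h := AdjoinRoot.eval₂_root f
    rw [hevgen, eq_intCast] at h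
    exact eq_neg_of_add_eq_zero_left h
  refine ⟨B', u, v, m, hm, huv, hvu, ρ (AdjoinRoot.root f), hu', ?_, ?_⟩
  · -- `Φ ≫ Φ = -d` exactly
    have h := congrArg ρ hroot2
    rw [map_mul, map_neg, map_intCast, End.mul_def] at h
    rw [h, Int.cast_natCast, ← nsmul_one, End.one_def]
    rfl
  · -- the `H¹`-action of `Φ`
    intro z
    have hm' : (m : ℚ) ≠ 0 := Nat.cast_ne_zero.2 hm.ne'
    have key := hρ (AdjoinRoot.root f)
    rw [hψroot, hxdef, AbelianVariety.endAlgebraTransport_algebraMap_mul_of] at key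
    have key' := congrArg (bettiRep B') key
    rw [map_mul, AlgHom.commutes, bettiRep_of, bettiRep_of, Algebra.algebraMap_eq_smul_one, smul_mul_assoc,
      one_mul] at key'
    have key'' := congrArg MulOpposite.unop key'
    rw [MulOpposite.unop_smul, MulOpposite.unop_op, MulOpposite.unop_op] at key''
    have hz := LinearMap.congr_fun key'' z
    rw [LinearMap.smul_apply] at hz
    rw [← hz, AbelianVariety.endConj_apply]
    change ((k : ℚ)⁻¹ * (m : ℚ)⁻¹) • bettiCohomology.map (v ≫ u₀ ≫ u).hom.hom.hom 1 z = _
    rw [bettiCohomology_map_comp_hom, bettiCohomology_map_comp_hom, mul_inv]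
    rfl

/-! ## Stage C: the glue with the rational Weil datum — `RiemannRealisableAt n d` in full -/

section Realise

variable {d : ℕ} {P : AbelianVariety ℂ} {ψ₀ : P ⟶ P} (e : ProjectiveEmbedding P.X)
  {a : complexBetti (projectiveSpace e.n ℂ) 2} (ha : IsRationalClass a) (ha0 : a ≠ 0)
  {m : ℕ} (hm : 1 ≤ m) (hPm : P.dim = m + 1) (hd' : 0 < d) (hψ : ψ₀ ≫ ψ₀ = -(d • 𝟙 P))
  {ω : complexBetti P.X (2 + 2 * m)} (hω : IsRationalClass ω) (hω0 : ω ≠ 0)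

/-- **RIEMANN'S EXISTENCE THEOREM AT WEIL TYPE — the body of `RealisedBy n d … J hW B Φ β`, for every Weil complex structure
`J`.** For `(P, ψ₀, e, a, ω)` as in `stub_riemannRealisable` (`dim P = 2n`, `ψ₀² = -d`, `d ≥ 1`) and every `J ∈ X⁺` on the rational
Weil datum `weilDatumOfKsymm …`, there are a complex abelian variety `B'` of dimension `2n`, an endomorphism `Φ` with
`Φ ≫ Φ = -d` EXACTLY, and a `ℚ`-linear isomorphism `β' : H¹(P(ℂ); ℚ) ≃ H¹(B'(ℂ); ℚ)` intertwining `ψ₀^*` with `Φ^*` and carrying the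
`(1,0)`-piece of `J`'s Hodge structure into `H^{1,0}(B')`. Assembly: Riemann's essential image (the tree's
`exists_abelianVariety_bettiOneHodgeStructure_hom_bijective`) realises `J`'s polarised Hodge structure as `H¹_B(B)`; `ψ₀^*` is a Hodge
endomorphism of it (`J` is `K ⊗ ℝ`-linear), so Riemann FULLNESS and faithfulness give `u₀ ∈ End B`, `u₀^* = k·(β ψ₀^* β⁻¹)`,
`u₀² = -k²d` (stage A); Shimura's principal model for the order `ℤ[X]/(X² + d)` gives an isogenous `B'` with `Φ² = -d` exactly and
`Φ^* = (km)⁻¹ v^* u₀^* u^*` (stage B); `β' := v^* ∘ β` intertwines and preserves `(1,0)`-classes (pull-back along `v`).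
[cite: DeligneMilne1982Tannakian, art. II §6 Thm. 6.20 (Riemann)] [cite: Deligne1982HodgeCycles, §4 Prop. 4.4, Lemma 4.6, proof of Thm. 4.8 p. 47]
[cite: Shimura1998, §7.1 Prop. 7] [cite: BirkenhakeLange2004, Thm. 4.2.1] -/
theorem exists_realisedBy_of_isWeilComplexStructure {n : ℕ} (hP : P.dim = 2 * n)
    (J : (weilDatumOfKsymm hm hPm hd' hψ e ha ha0 hω hω0).Cx →ₗ[ℂ] (weilDatumOfKsymm hm hPm hd' hψ e ha ha0 hω hω0).Cx)
    (hW : Motives.IsWeilComplexStructure (weilDatumOfKsymm hm hPm hd' hψ e ha ha0 hω hω0).hForm J) :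
    ∃ (B : AbelianVariety ℂ) (Φ : B ⟶ B) (β : bettiCohomology P.X 1 ≃ₗ[ℚ] bettiCohomology B.X 1),
      B.dim = 2 * n ∧ Φ ≫ Φ = -((d : ℤ) • 𝟙 B) ∧
      (∀ x, β (bettiCohomology.map ψ₀.hom.hom.hom 1 x) = bettiCohomology.map Φ.hom.hom.hom 1 (β x)) ∧
      ∀ x ∈ ((weilDatumOfKsymm hm hPm hd' hψ e ha ha0 hω hω0).hodgeStructure J hW.sq).piece 1 0,
        IsOfHodgeType (2 * n) B.X 1 1 0
          (Motives.ofRatClassBaseChange (ComplexPoints B.X) 1 (β.toLinearMap.baseChange ℂ x)) := by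
  classical
  haveI : Module.Finite ℚ (bettiCohomology P.X 1) := finite_bettiCohomology_one P
  set H := (weilDatumOfKsymm hm hPm hd' hψ e ha ha0 hω hω0).hodgeStructure J hW.sq with hHdef
  have hpol : H.IsPolarizable := (weilDatumOfKsymm hm hPm hd' hψ e ha ha0 hω hω0).isPolarizable_hodgeStructure J hW
  have heff : H.IsEffective := Motives.HodgeStructure.isEffective_hodgeStructureOfCx _ _
  -- (1) Riemann's essential image: `H ≅ H¹_B(B)`
  obtain ⟨B, M, hM, f, hf, hdim⟩ := exists_abelianVariety_bettiOneHodgeStructure_hom_bijective H hpol heff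
  have hBdim : B.dim = 2 * n := by have h2 := finrank_bettiCohomology_one P; omega
  set g := f.symmOfBijective hf with hgdef
  have hfg : ∀ w, f.toLinearMap (g.toLinearMap w) = w := fun w => f.apply_symmOfBijective_apply hf w
  have hgf : ∀ v, g.toLinearMap (f.toLinearMap v) = v := fun v => f.symmOfBijective_apply_apply hf v
  have hXB : Motives.IsSmoothProjective B.dim B.X := AbelianVariety.isSmoothProjective_holds
  have hpieceB : (bettiOneHodgeStructure B M hM).piece 1 0 = M.ratPiece AbelianVariety.isSmoothProjective_holds 1 1 0 := by
    rw [bettiOneHodgeStructure, Motives.HodgeStructure.cast_piece]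
    exact_mod_cast M.piece_eq_ratPiece AbelianVariety.isSmoothProjective_holds hM (show 1 + 0 = 1 from rfl)
  -- (2) the transported `K`-action `αB = g ψ₀^* f` and its properties
  set αB : bettiCohomology B.X 1 →ₗ[ℚ] bettiCohomology B.X 1 := g.toLinearMap ∘ₗ (weilDatumOfKsymm hm hPm hd' hψ e ha ha0 hω hω0).α ∘ₗ f.toLinearMap with hαBdef
  have hαα : ∀ x, (weilDatumOfKsymm hm hPm hd' hψ e ha ha0 hω hω0).α ((weilDatumOfKsymm hm hPm hd' hψ e ha ha0 hω hω0).α x) = -((d : ℚ) • x) := fun x => (weilDatumOfKsymm hm hPm hd' hψ e ha ha0 hω hω0).α_α x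
  have hsq : ∀ y, αB (αB y) = -((d : ℚ) • y) := by
    intro y
    simp only [hαBdef, LinearMap.comp_apply, hfg]
    rw [hαα, map_neg, map_smul, hgf]
  have hpiece : ∀ z, z ∈ H.piece 1 0 → (weilDatumOfKsymm hm hPm hd' hψ e ha ha0 hω hω0).α.baseChange ℂ z ∈ H.piece 1 0 := by
    intro z hz
    rw [hHdef, Motives.WeilDatum.piece_one_zero_hodgeStructure] at hz ⊢
    exact Motives.HodgeStructure.baseChange_mem_cxF1 ((weilDatumOfKsymm hm hPm hd' hψ e ha ha0 hω hω0).realJ J) (weilDatumOfKsymm hm hPm hd' hψ e ha ha0 hω hω0).α (fun a => (weilDatumOfKsymm hm hPm hd' hψ e ha ha0 hω hω0).αℝ_realJ J a) hz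
  have hH : ∀ y : ℂ ⊗[ℚ] bettiCohomology B.X 1,
      IsOfHodgeType B.dim B.X 1 1 0 (Motives.ofRatClassBaseChange (ComplexPoints B.X) 1 y) →
      IsOfHodgeType B.dim B.X 1 1 0 (Motives.ofRatClassBaseChange (ComplexPoints B.X) 1 (αB.baseChange ℂ y)) := by
    intro y hy
    have hy' : y ∈ (bettiOneHodgeStructure B M hM).piece 1 0 := by
      rw [hpieceB]; exact M.mem_ratPiece_of_isOfHodgeType AbelianVariety.isSmoothProjective_holds hy
    have h1 := f.baseChange_mapsTo_piece 1 0 hy'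
    have h2 := hpiece _ h1
    have h3 := g.baseChange_mapsTo_piece 1 0 h2
    have hcomp : αB.baseChange ℂ y = g.toLinearMap.baseChange ℂ ((weilDatumOfKsymm hm hPm hd' hψ e ha ha0 hω hω0).α.baseChange ℂ (f.toLinearMap.baseChange ℂ y)) := by
      rw [hαBdef, LinearMap.baseChange_comp, LinearMap.baseChange_comp, LinearMap.comp_apply, LinearMap.comp_apply]
    rw [hcomp]
    exact isOfHodgeType_of_mem_piece_bettiOneHodgeStructure B M hM h3
  -- (3) stage A and stage B
  obtain ⟨u₀, k, hk, hu₀, hu₀2⟩ := exists_end_of_hodgeEndomorphism_sq αB hsq hH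
  obtain ⟨B', u, v, mB, hmB, huv, hvu, Φ, hu', hΦ2, hΦH⟩ := exists_isogenous_sqrt_of_sq (d := d) hk hu₀2
  have hB'dim : B'.dim = 2 * n := by rw [← AbelianVariety.dim_eq_of_isIsogeny hu', hBdim]
  -- (4) the marking `β' = v^* ∘ g`
  have hvu' : ∀ z : bettiCohomology B'.X 1,
      bettiCohomology.map v.hom.hom.hom 1 (bettiCohomology.map u.hom.hom.hom 1 z) = (mB : ℚ) • z := by
    intro z
    have h := congrArg (fun F => (ModuleCat.Hom.hom F) z) (bettiCohomology_map_comp_hom v u 1)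
    simp only [ModuleCat.hom_comp, LinearMap.comp_apply] at h
    rw [hvu, bettiCohomology_map_nsmul_id_one] at h
    rw [← h, ← Nat.cast_smul_eq_nsmul ℚ mB]
    rfl
  have huv' : ∀ y : bettiCohomology B.X 1,
      bettiCohomology.map u.hom.hom.hom 1 (bettiCohomology.map v.hom.hom.hom 1 y) = (mB : ℚ) • y := by
    intro y
    have h := congrArg (fun F => (ModuleCat.Hom.hom F) y) (bettiCohomology_map_comp_hom u v 1)
    simp only [ModuleCat.hom_comp, LinearMap.comp_apply] at h
    rw [huv, bettiCohomology_map_nsmul_id_one] at h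
    rw [← h, ← Nat.cast_smul_eq_nsmul ℚ mB]
    rfl
  have hmB' : (mB : ℚ) ≠ 0 := Nat.cast_ne_zero.2 hmB.ne'
  have hk' : (k : ℚ) ≠ 0 := Nat.cast_ne_zero.2 hk.ne'
  let vStar : bettiCohomology B.X 1 ≃ₗ[ℚ] bettiCohomology B'.X 1 :=
    LinearEquiv.ofLinear (bettiCohomology.map v.hom.hom.hom 1).hom ((mB : ℚ)⁻¹ • (bettiCohomology.map u.hom.hom.hom 1).hom)
      (by
        refine LinearMap.ext fun z => ?_
        rw [LinearMap.comp_apply, LinearMap.smul_apply, map_smul, LinearMap.id_apply]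
        change (mB : ℚ)⁻¹ • bettiCohomology.map v.hom.hom.hom 1 (bettiCohomology.map u.hom.hom.hom 1 z) = z
        rw [hvu', smul_smul, inv_mul_cancel₀ hmB', one_smul])
      (by
        refine LinearMap.ext fun y => ?_
        rw [LinearMap.comp_apply, LinearMap.smul_apply, LinearMap.id_apply]
        change (mB : ℚ)⁻¹ • bettiCohomology.map u.hom.hom.hom 1 (bettiCohomology.map v.hom.hom.hom 1 y) = y
        rw [huv', smul_smul, inv_mul_cancel₀ hmB', one_smul])
  let β : bettiCohomology P.X 1 ≃ₗ[ℚ] bettiCohomology B.X 1 :=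
    LinearEquiv.ofBijective g.toLinearMap (f.symmOfBijective_bijective hf)
  have hβ'ap : ∀ x, (β.trans vStar) x = bettiCohomology.map v.hom.hom.hom 1 (g.toLinearMap x) := fun x => rfl
  refine ⟨B', Φ, β.trans vStar, hB'dim, by rw [hΦ2, natCast_zsmul], ?_, ?_⟩
  · -- intertwining
    intro x
    rw [hβ'ap, hβ'ap, hΦH, huv', map_smul, map_smul, hu₀, smul_smul]
    have hαg : αB (g.toLinearMap x) = g.toLinearMap ((weilDatumOfKsymm hm hPm hd' hψ e ha ha0 hω hω0).α x) := by
      simp only [hαBdef, LinearMap.comp_apply, hfg]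
    rw [← Nat.cast_smul_eq_nsmul ℚ k, map_smul, smul_smul, hαg]
    have hc : ((k : ℚ) * mB)⁻¹ * (mB : ℚ) * (k : ℚ) = 1 := by field_simp
    rw [hc, one_smul]
    rfl
  · -- the `(1,0)`-clause, pulled back along `v`
    intro x hx
    have h3 := g.baseChange_mapsTo_piece 1 0 hx
    have hB10 := isOfHodgeType_of_mem_piece_bettiOneHodgeStructure B M hM h3
    obtain ⟨M'⟩ := nonempty_hodgeModel_holds (n := B'.dim) (X := B'.X) AbelianVariety.isSmoothProjective_holds
    have hpull := hB10.map_of_le (m := B'.dim) AbelianVariety.isSmoothProjective_holds hXB M' v.hom.hom.hom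
      (by rw [hB'dim, hBdim])
    rw [← HodgeModel.ofRatClassBaseChange_baseChange_map] at hpull
    rw [← hB'dim]
    convert hpull using 2
    rw [LinearEquiv.coe_trans, LinearMap.baseChange_comp, LinearMap.comp_apply]
    rfl

end Realise

end Summit.HodgeConjecture.HodgeConjecture.Theorems

end
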